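import Literature.NumberTheory.EllipticCurves.KleinFrickeLevelTwentySeven
import Literature.NumberTheory.EllipticCurves.VariableChangePointsMap
import Mathlib.RingTheory.Polynomial.RationalRoot
import Mathlib.Tactic.ComputeDegree
import HarnessLib

/-!
# No elliptic curve over `ℚ` has a rational point of order `27` (the case `m = 27` of Mazur's
# Thm. (7'); Ligozat / Kenku: `X₀(27)(ℚ)`, Kubert: `X₁(9)`)

Topic `NumberTheory/EllipticCurves`; a PROOFS file (theorems only, no `def`, no named fact) for the
`n = 27` leaf of Mazur's "First reduction" (hypothesis `h` of
`Literature.NumberTheory.EllipticCurves.Mazur1977_reduction_to_primes_of_leaves`, file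
`MazurTorsionReductionProofs`; Mazur 1977, Ch. III §5, p. 156). The cases `n = 14`, `15` are
`KubertFourteenProofs`, `KubertFifteenProofs`. Main result:
**`not_exists_addOrderOf_eq_twentySeven`** — for every elliptic curve `V/ℚ` (any `DecidableEq ℚ`
instance for Mathlib's group law), `¬ ∃ P ∈ V(ℚ), ord P = 27`.

## Proof (every input is in the tree; no modular curves)

1. A rational point `P` of order `27` spans a Galois-stable cyclic subgroup, so by the tree's
   modular-curve-free level-`27` theorem `WeierstrassCurve.exists_XZeroTwentySeven_of_torsion`
   (Klein–Fricke at level `9` twice + Vélu, file `KleinFrickeLevelTwentySeven`, run over the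
   trivial extension `ℚ/ℚ`) there is a rational point `(η, η')` of the plane model
   `η'(η'² + 9η' + 27)(η² + 9η + 27) = η³` of `X₀(27)` with `η ≠ 0` and
   `j(V) η(η² + 9η + 27) = (η + 3)³(η³ + 9η² + 27η + 3)³`; by Euler's case `n = 3` of Fermat
   (`XZeroTwentySeven.rat_point_eq`) `η = -9`, whence `j(V) = -2¹⁵·3·5³ = -12288000`
   (`XZeroTwentySeven.j_eq_of_eta_eq`; Ligozat/Kenku: the non-cuspidal points of `X₀(27)(ℚ)`).
2. `Q = 3P` is a rational point of order `9`; Klein–Fricke at level `9` with the VALUE of the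
   Hauptmodul (`WeierstrassCurve.exists_hauptmodul_nine_eq_of_torsion`) gives `η₉ ∈ ℚ` with
   `-12288000 · η₉(η₉² + 9η₉ + 27) = (η₉ + 3)³(η₉³ + 9η₉² + 27η₉ + 3)³` and
   `η₉ = (f³ - 6f² + 3f + 1)/(f(f - 1))` for Kubert's coordinate `f = f(Q) ∈ ℚ` on `X₁(9)`.
3. The first relation is a monic integer polynomial equation of degree `12` in `η₉` with constant
   term `3⁶`, so `η₉ ∈ ℤ`, `η₉ ∣ 3⁶` (rational root theorem, Mathlib
   `isInteger_of_is_root_of_monic`), and of the fourteen candidates only `η₉ = -9` is a root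
   (`norm_num`). Then `f³ + 3f² - 6f + 1 = 0`, a monic integer cubic with constant term `1` and
   `f(±1) ≠ 0` — contradiction. (Equivalently: the curves over `ℚ` with a rational `27`-isogeny,
   `j = -12288000`, i.e. `27a2`, `27a4` and their twists, carry no rational point of order `9`.)

## References

* [Mazur1977] B. Mazur, *Modular curves and the Eisenstein ideal*, Publ. Math. IHÉS 47 (1977):
  Thm. (7') p. 35; Ch. III §5, First reduction, p. 156.
* [Kubert1976] D. S. Kubert, *Universal bounds on the torsion of elliptic curves*, Proc. London
  Math. Soc. (3) 33 (1976) 193–237, Ch. IV and Table 3 (`N = 9`).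
* [Maier2006] R. S. Maier, *On rationally parametrized modular equations*, J. Ramanujan Math.
  Soc. 24 (2009), Table 4 (`N = 9, 27`) and §5.
-/

noncomputable section

open WeierstrassCurve Polynomial

namespace Literature.NumberTheory.EllipticCurves

/-! ### §1. Two rational-root computations -/

/-- The rational solutions of the level-`9` relation `j · η(η² + 9η + 27) = (η+3)³(η³+9η²+27η+3)³`
at the CM value `j = -12288000`: only `η = -9` (the relation is monic of degree `12` in `η` over
`ℤ` with constant term `3⁶`; rational root theorem and fourteen evaluations). [folklore] -/
private theorem eta_eq_neg_nine_of_j {η : ℚ}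
    (h : -12288000 * (η * (η ^ 2 + 9 * η + 27)) =
      (η + 3) ^ 3 * (η ^ 3 + 9 * η ^ 2 + 27 * η + 3) ^ 3) : η = -9 := by
  -- `η` is a root of a monic integer polynomial, hence an integer
  have hmon : (X ^ 12 + (C 36 * X ^ 11 + C 594 * X ^ 10 + C 5868 * X ^ 9 + C 38151 * X ^ 8 +
      C 169128 * X ^ 7 + C 512028 * X ^ 6 + C 1028376 * X ^ 5 + C 1276479 * X ^ 4 +
      C 13128564 * X ^ 3 + C 110795634 * X ^ 2 + C 331796412 * X + C 729) : ℤ[X]).Monic := by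
    monicity!
  have hroot : aeval η (X ^ 12 + (C 36 * X ^ 11 + C 594 * X ^ 10 + C 5868 * X ^ 9 +
      C 38151 * X ^ 8 + C 169128 * X ^ 7 + C 512028 * X ^ 6 + C 1028376 * X ^ 5 +
      C 1276479 * X ^ 4 + C 13128564 * X ^ 3 + C 110795634 * X ^ 2 + C 331796412 * X +
      C 729) : ℤ[X]) = 0 := by
    simp only [map_add, map_mul, map_pow, aeval_X, aeval_C, algebraMap_int_eq,
      Int.coe_castRingHom, Int.cast_ofNat]
    linear_combination -h
  obtain ⟨m, hm⟩ := isInteger_of_is_root_of_monic hmon hroot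
  have hm' : (m : ℚ) = η := by simpa using hm
  subst hm'
  have hq : ((m : ℚ) + 3) ^ 3 * ((m : ℚ) ^ 3 + 9 * (m : ℚ) ^ 2 + 27 * (m : ℚ) + 3) ^ 3 +
      12288000 * ((m : ℚ) * ((m : ℚ) ^ 2 + 9 * (m : ℚ) + 27)) = 0 := by
    linear_combination -h
  have hpm : (m + 3) ^ 3 * (m ^ 3 + 9 * m ^ 2 + 27 * m + 3) ^ 3 +
      12288000 * (m * (m ^ 2 + 9 * m + 27)) = 0 := by
    exact_mod_cast hq
  -- `m ∣ 3⁶`: fourteen candidates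
  have hdvd : m ∣ 3 ^ 6 := ⟨-(m ^ 11 + 36 * m ^ 10 + 594 * m ^ 9 + 5868 * m ^ 8 + 38151 * m ^ 7 +
      169128 * m ^ 6 + 512028 * m ^ 5 + 1028376 * m ^ 4 + 1276479 * m ^ 3 + 13128564 * m ^ 2 +
      110795634 * m + 331796412), by linear_combination hpm⟩
  have h36 : m.natAbs ∣ 3 ^ 6 := by
    have h' := Int.natAbs_dvd_natAbs.mpr hdvd
    rwa [Int.natAbs_pow] at h'
  obtain ⟨k, hk, hmk⟩ := (Nat.dvd_prime_pow Nat.prime_three).mp h36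
  interval_cases k <;> rcases Int.natAbs_eq_iff.mp hmk with rfl | rfl <;> norm_num at hpm
  norm_num

/-- `f³ + 3f² - 6f + 1` has no rational root (a rational root would be an integer dividing `1`,
and `f(1) = -1`, `f(-1) = 9`). [folklore] -/
private theorem cubic_ne_zero (f : ℚ) : f ^ 3 + 3 * f ^ 2 - 6 * f + 1 ≠ 0 := by
  intro h
  have hmon : (X ^ 3 + (C 3 * X ^ 2 - C 6 * X + C 1) : ℤ[X]).Monic := by monicity!
  have hroot : aeval f (X ^ 3 + (C 3 * X ^ 2 - C 6 * X + C 1) : ℤ[X]) = 0 := by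
    simp only [map_add, map_sub, map_mul, map_pow, aeval_X, aeval_C, algebraMap_int_eq,
      Int.coe_castRingHom, Int.cast_ofNat, Int.cast_one]
    linear_combination h
  obtain ⟨m, hm⟩ := isInteger_of_is_root_of_monic hmon hroot
  have hm' : (m : ℚ) = f := by simpa using hm
  subst hm'
  have hpm : m ^ 3 + 3 * m ^ 2 - 6 * m + 1 = 0 := by exact_mod_cast h
  rcases Int.eq_one_or_neg_one_of_mul_eq_one (u := m) (v := -(m ^ 2 + 3 * m - 6))
      (by linear_combination -hpm) with rfl | rfl <;> norm_num at hpm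

/-! ### §2. No rational point of order `27` -/

/-- **No rational point of order `27` (the case `m = 27` of Mazur's Thm. (7'); Ligozat/Kenku
`X₀(27)(ℚ)` + Kubert's `X₁(9)`).** For every elliptic curve `V` over `ℚ`, no point of `V(ℚ)` has
order `27` — the `n = 27` conjunct of the hypothesis of `Mazur1977_reduction_to_primes_of_leaves`
(Mazur 1977, Ch. III §5, p. 156); proof in the module docstring (a rational `27`-torsion point
gives a rational point of `X₀(27)`, so `j = -12288000`; then the level-`9` Hauptmodul at `3P` is
`-9`, and Kubert's coordinate `f(3P)` would be a rational root of `f³ + 3f² - 6f + 1`). Stated for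
an arbitrary `DecidableEq ℚ` instance, as the group law of `V.toAffine.Point` is.
[cite: Mazur1977, Thm. (7') p. 35 and Ch. III §5 p. 156; Kubert1976, Ch. IV and Table 3 (N = 9)] -/
theorem not_exists_addOrderOf_eq_twentySeven [inst : DecidableEq ℚ] (V : WeierstrassCurve ℚ)
    [V.IsElliptic] : ¬ ∃ P : V.toAffine.Point, addOrderOf P = 27 := by
  obtain rfl : inst = Classical.decEq ℚ := Subsingleton.elim _ _
  letI : DecidableEq ℚ := Classical.decEq ℚ
  rintro ⟨P, hP⟩
  -- `V` as a curve over the trivial Galois extension `ℚ/ℚ`; every point is Galois-stable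
  have hV : V = V.baseChange ℚ := by
    rw [WeierstrassCurve.baseChange, Algebra.algebraMap_self, WeierstrassCurve.map_id]
  have hσ : ∀ (Q : (V.baseChange ℚ).toAffine.Point) (σ : ℚ ≃ₐ[ℚ] ℚ),
      σ • Q ∈ AddSubgroup.zmultiples Q := fun Q σ ↦ by
    rw [Subsingleton.elim σ 1, one_smul]
    exact AddSubgroup.mem_zmultiples Q
  have hP' : addOrderOf (Affine.Point.congrEquiv hV P) = 27 := by rw [AddEquiv.addOrderOf_eq, hP]
  -- `X₀(27)(ℚ)`: `η = -9`, `j(V) = -2¹⁵·3·5³`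
  obtain ⟨η, η', hη0, hj, hX⟩ :=
    exists_XZeroTwentySeven_of_torsion (F := ℚ) (W := V) hP' (hσ _)
  have hη : η ≠ 0 := fun e ↦ hη0 (by rw [e, zero_mul])
  have hjV : V.j = -12288000 :=
    XZeroTwentySeven.j_eq_of_eta_eq (XZeroTwentySeven.rat_point_eq hη hX).2 hj
  -- `Q = 3P` has order `9`; the level-`9` Hauptmodul at `Q` and Kubert's coordinate `f(Q)`
  have h9 : addOrderOf ((3 : ℕ) • Affine.Point.congrEquiv hV P) = 9 := by
    rw [addOrderOf_nsmul' _ (by norm_num : (3 : ℕ) ≠ 0), hP']; decide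
  rcases hQ : (3 : ℕ) • Affine.Point.congrEquiv hV P with _ | ⟨x₀, y₀, h₀⟩
  · rw [hQ, ← Affine.Point.zero_def, addOrderOf_zero] at h9; omega
  rw [hQ] at h9
  obtain ⟨η₉, hη₉f, -, hj₉⟩ := exists_hauptmodul_nine_eq_of_torsion (F := ℚ) (W := V) h9 (hσ _)
  rw [hjV] at hj₉
  rw [eta_eq_neg_nine_of_j hj₉, Algebra.algebraMap_self_apply] at hη₉f
  generalize (V.baseChange ℚ).tateNine x₀ y₀ = f at hη₉f
  -- `-9 = (f³ - 6f² + 3f + 1)/(f(f - 1))`, so `f³ + 3f² - 6f + 1 = 0`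
  by_cases hf : f * (f - 1) = 0
  · rw [hf, div_zero] at hη₉f
    norm_num at hη₉f
  · rw [eq_div_iff hf] at hη₉f
    exact cubic_ne_zero f (by linear_combination -hη₉f)

end Literature.NumberTheory.EllipticCurves

end
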